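import Summits.ABC.ABC.Theses.PadicPrincipalCoreRadThree
import Summits.ABC.StewartYu.KappaDoorEpsShape
import HarnessLib

/-!
# Route PadicPrincipalCoreRadThree, item `OddKappaDoorSpec`: closed by the cell's κ-door

`Summits/ABC/ABC/Theorems/PadicPrincipalCoreRadThreeOddKappaDoor.lean` — cell `abc-stewartyu`, seat p3.
The one-prime bound with `σ ≤ 2` at every odd prime gives `EpsShapeBound (max 1 κ)`:
`Summit.ABC.StewartYu.KappaDoor.epsShapeBound_of_oddFinBound` (`KappaDoorEpsShape.lean`).
-/

set_option linter.dupNamespace false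

namespace Summit.ABC.ABC.Theorems

/-- **Item `OddKappaDoorSpec` of route PadicPrincipalCoreRadThree.** [folklore] -/
theorem padicPrincipalCoreRadThree_oddKappaDoorSpec_proof :
    Summit.ABC.ABC.Theses.PadicPrincipalCoreRadThree.OddKappaDoorSpec := by
  unfold Summit.ABC.ABC.Theses.PadicPrincipalCoreRadThree.OddKappaDoorSpec
  intro K L κ σ τ τ₁ hK hL _hκ0 hσ0 hσ h
  exact Summit.ABC.StewartYu.KappaDoor.epsShapeBound_of_oddFinBound hK hL hσ0 hσ
    (fun p hp hp2 => h p hp hp2)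

end Summit.ABC.ABC.Theorems
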